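import Mathlib
import Summits.NavierStokesRegularity.NavierStokesRegularity.Theorems.LandauTailLandauTailBlowupTypeIIFatou
import Summits.NavierStokesRegularity.NavierStokesRegularity.Theorems.LandauTailLandauTailBlowupSlice

/-!
# Every supercritical Lebesgue norm of the slices of a Landau-tailed field diverges on fixed balls

Helper file for crux `LandauTailBlowup` (stmt-NavierStokesRegularity-1944), line `registered`,
registered stub `landauTail_slice_Lq_tendsto_top` (D9, "every supercritical Lebesgue norm of the
slices diverges on every fixed ball").

If a field `u : ℝ → ℝ³ → ℝ³`, jointly continuous on `(-1, 0) × ℝ³`, has the pointwise parabolic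
tail `√(-t) u(t, √(-t) y) → U y` (`t → 0⁻`, `y ≠ 0`) to a nonzero `(-1)`-homogeneous profile `U`
continuous off the origin, then for every real `q ≥ 3` and every fixed ball `B_δ`, `δ > 0`, the
slice norms `∫_{B_δ} ‖u(t)‖^q` tend to `∞` as `t → 0⁻` (so the local Escauriaza–Seregin–Šverák
necessary condition for blow-up holds for free for such fields).

Proof: by Fatou along any sequence `t_k → 0⁻`, the `L^q(B_1)` norms of the rescaled slices
`v_t(y) = √(-t) u(t, √(-t) y)` tend to `∞` (their a.e. limit `U` has `∫_{B_1} ‖U‖^q = ∞`,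
`landauTail_lintegral_profile_rpow_eq_top`); by the slice identity `landauTail_slice_identity`,
`∫_{B_1} ‖v_t‖^q = (-t)^{(q-3)/2} ∫_{B_{√(-t)}} ‖u(t)‖^q ≤ ∫_{B_δ} ‖u(t)‖^q` once
`-t ≤ min 1 δ²`.
-/

set_option linter.dupNamespace false

namespace Summit.NavierStokesRegularity.NavierStokesRegularity.Theorems

open MeasureTheory Set Filter Topology Metric
open scoped ENNReal NNReal

/-- **The rescaled slices diverge in `L^q(B_1)` for `q ≥ 3`** [folklore; Fatou's lemma]: if the
slices `u t`, `t ∈ (-1, 0)`, are continuous, `√(0 - t) • u t (√(0 - t) • y) → U y` as `t → 0⁻`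
for `y ≠ 0`, and `U` is continuous off the origin, `(-1)`-homogeneous and nonzero, then
`∫_{B_1} ‖√(0 - t) • u t (√(0 - t) • y)‖^q dy → ∞` as `t → 0⁻` for every real `q ≥ 3`:
otherwise some level `M` is undershot along a sequence `t_k → 0⁻`, along which the rescaled
slices converge a.e. on `B_1` to `U ∉ L^q(B_1)` (`landauTail_lintegral_profile_rpow_eq_top`),
contradicting Fatou's lemma. -/
theorem landauTail_rescaledSlice_lintegral_tendsto_top
    (u : ℝ → EuclideanSpace ℝ (Fin 3) → EuclideanSpace ℝ (Fin 3))
    (U : EuclideanSpace ℝ (Fin 3) → EuclideanSpace ℝ (Fin 3))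
    (hu : ∀ t ∈ Ioo (-1 : ℝ) 0, Continuous (u t)) (hUc : ContinuousOn U {0}ᶜ)
    (hhom : ∀ c : ℝ, 0 < c → ∀ x : EuclideanSpace ℝ (Fin 3), U (c • x) = c⁻¹ • U x)
    (hne : ∃ x : EuclideanSpace ℝ (Fin 3), U x ≠ 0)
    (htail : ∀ y : EuclideanSpace ℝ (Fin 3), y ≠ 0 → Tendsto
      (fun t : ℝ => Real.sqrt (0 - t) • u t (Real.sqrt (0 - t) • y)) (𝓝[<] 0) (𝓝 (U y)))
    {q : ℝ} (hq : 3 ≤ q) :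
    Tendsto (fun t : ℝ => ∫⁻ y in ball (0 : EuclideanSpace ℝ (Fin 3)) 1,
      ‖Real.sqrt (0 - t) • u t (Real.sqrt (0 - t) • y)‖ₑ ^ q) (𝓝[<] 0) (𝓝 ⊤) := by
  rw [ENNReal.tendsto_nhds_top_iff_nnreal]
  intro M
  by_contra hcon
  have hfreq : ∃ᶠ t in 𝓝[<] (0 : ℝ), (∫⁻ y in ball (0 : EuclideanSpace ℝ (Fin 3)) 1,
      ‖Real.sqrt (0 - t) • u t (Real.sqrt (0 - t) • y)‖ₑ ^ q) ≤ M := by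
    rw [not_eventually] at hcon
    exact hcon.mono fun t ht => not_lt.1 ht
  -- a sequence of times `t_k → 0⁻` inside `(-1, 0)` along which the level `M` is undershot
  obtain ⟨tk, htk_lim, htk⟩ := exists_seq_forall_of_frequently
    (hfreq.and_eventually (Ioo_mem_nhdsLT (by norm_num : (-1 : ℝ) < 0)))
  -- the rescaled slices and their a.e. limit on `B_1`
  set v : ℕ → EuclideanSpace ℝ (Fin 3) → EuclideanSpace ℝ (Fin 3) :=
    fun k y => Real.sqrt (0 - tk k) • u (tk k) (Real.sqrt (0 - tk k) • y)
  have hvm : ∀ k, AEMeasurable (fun y => ‖v k y‖ₑ ^ q)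
      (volume.restrict (ball (0 : EuclideanSpace ℝ (Fin 3)) 1)) := by
    intro k
    have hc : Continuous (v k) := by
      show Continuous fun y => Real.sqrt (0 - tk k) • u (tk k) (Real.sqrt (0 - tk k) • y)
      exact ((hu _ (htk k).2).comp (continuous_const_smul (Real.sqrt (0 - tk k)))).const_smul
        (Real.sqrt (0 - tk k))
    exact (hc.measurable.enorm.pow_const q).aemeasurable
  have hae : ∀ᵐ y ∂(volume.restrict (ball (0 : EuclideanSpace ℝ (Fin 3)) 1)),
      liminf (fun k => ‖v k y‖ₑ ^ q) atTop = ‖U y‖ₑ ^ q := by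
    refine ae_restrict_of_ae ?_
    filter_upwards [compl_mem_ae_iff.2 (measure_singleton (0 : EuclideanSpace ℝ (Fin 3)))]
      with y hy
    have ht := ((htail y hy).comp htk_lim).enorm
    exact ((ENNReal.continuous_rpow_const.tendsto _).comp ht).liminf_eq
  -- Fatou
  have hle : ∫⁻ y in ball (0 : EuclideanSpace ℝ (Fin 3)) 1, ‖U y‖ₑ ^ q ≤ M :=
    calc ∫⁻ y in ball (0 : EuclideanSpace ℝ (Fin 3)) 1, ‖U y‖ₑ ^ q
        = ∫⁻ y in ball (0 : EuclideanSpace ℝ (Fin 3)) 1, liminf (fun k => ‖v k y‖ₑ ^ q) atTop :=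
          (lintegral_congr_ae hae).symm
      _ ≤ liminf (fun k => ∫⁻ y in ball (0 : EuclideanSpace ℝ (Fin 3)) 1, ‖v k y‖ₑ ^ q) atTop :=
          lintegral_liminf_le' hvm
      _ ≤ M := liminf_le_of_frequently_le' (Frequently.of_forall fun k => (htk k).1)
  rw [landauTail_lintegral_profile_rpow_eq_top U hUc hhom hne q hq] at hle
  exact ENNReal.coe_ne_top (top_le_iff.1 hle)

/-- **Every supercritical Lebesgue norm of the slices diverges on every fixed ball**
[folklore; Fatou's lemma and spatial scaling] (registered stub D9 of crux `LandauTailBlowup`,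
stmt-NavierStokesRegularity-1944): let `u : ℝ → ℝ³ → ℝ³` be jointly continuous on
`(-1, 0) × ℝ³` with the pointwise parabolic tail `√(0 - t) • u t (√(0 - t) • y) → U y`
(`t → 0⁻`) for every `y ≠ 0`, the profile `U` being continuous off the origin,
`(-1)`-homogeneous and not identically zero. Then for every real `q ≥ 3` and every `δ > 0`,
`∫_{B_δ} ‖u(t)‖^q → ∞` as `t → 0⁻` (the local Escauriaza–Seregin–Šverák necessary condition,
for free). Proof: the `L^q(B_1)` norms of the rescaled slices diverge
(`landauTail_rescaledSlice_lintegral_tendsto_top`), and by the slice identity they equal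
`(-t)^{(q-3)/2} ∫_{B_{√(-t)}} ‖u(t)‖^q ≤ ∫_{B_δ} ‖u(t)‖^q` as soon as `-t ≤ min 1 δ²`. -/
theorem landauTail_slice_Lq_tendsto_top : ∀ (u : ℝ → EuclideanSpace ℝ (Fin 3) → EuclideanSpace ℝ (Fin 3)) (U : EuclideanSpace ℝ (Fin 3) → EuclideanSpace ℝ (Fin 3)), ContinuousOn (Function.uncurry u) (Set.Ioo (-1 : ℝ) 0 ×ˢ Set.univ) → ContinuousOn U {0}ᶜ → (∀ c : ℝ, 0 < c → ∀ x : EuclideanSpace ℝ (Fin 3), U (c • x) = c⁻¹ • U x) → (∃ x : EuclideanSpace ℝ (Fin 3), U x ≠ 0) → (∀ y : EuclideanSpace ℝ (Fin 3), y ≠ 0 → Filter.Tendsto (fun t : ℝ => Real.sqrt (0 - t) • u t (Real.sqrt (0 - t) • y)) (nhdsWithin 0 (Set.Iio 0)) (nhds (U y))) → ∀ q : ℝ, 3 ≤ q → ∀ δ : ℝ, 0 < δ → Filter.Tendsto (fun t : ℝ => ∫⁻ x in Metric.ball (0 : EuclideanSpace ℝ (Fin 3)) δ, ‖u t x‖ₑ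 ^ q) (nhdsWithin 0 (Set.Iio 0)) (nhds ⊤) := by
  intro u U hu hUc hhom hne htail q hq δ hδ
  have hq0 : 0 ≤ q := by linarith
  -- the slices are continuous
  have huc : ∀ t ∈ Ioo (-1 : ℝ) 0, Continuous (u t) := fun t ht =>
    hu.comp_continuous (Continuous.prodMk_right t) fun x => ⟨ht, mem_univ _⟩
  refine tendsto_nhds_top_mono
    (landauTail_rescaledSlice_lintegral_tendsto_top u U huc hUc hhom hne htail hq) ?_
  -- for `-t ≤ min 1 δ²`: `∫_{B_1} ‖v_t‖^q = (-t)^{(q-3)/2} ∫_{B_{√(-t)}} ‖u t‖^q ≤ ∫_{B_δ} ‖u t‖^q`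
  have hmem : Ioo (-min 1 (δ ^ 2)) 0 ∈ 𝓝[<] (0 : ℝ) :=
    Ioo_mem_nhdsLT (neg_neg_of_pos (lt_min one_pos (pow_pos hδ 2)))
  filter_upwards [hmem] with t ht
  have hnt : 0 < -t := neg_pos.2 ht.2
  have ht1 : -t ≤ 1 := by linarith [ht.1, min_le_left (1 : ℝ) (δ ^ 2)]
  have htδ : -t ≤ δ ^ 2 := by linarith [ht.1, min_le_right (1 : ℝ) (δ ^ 2)]
  rw [landauTail_slice_identity (u t) hq0 ht.2]
  calc ENNReal.ofReal ((-t) ^ ((q - 3) / 2)) *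
        ∫⁻ x in ball (0 : EuclideanSpace ℝ (Fin 3)) (Real.sqrt (-t)), ‖u t x‖ₑ ^ q
      ≤ 1 * ∫⁻ x in ball (0 : EuclideanSpace ℝ (Fin 3)) δ, ‖u t x‖ₑ ^ q :=
        mul_le_mul' (ENNReal.ofReal_le_one.2 (Real.rpow_le_one hnt.le ht1 (by linarith)))
          (lintegral_mono_set (ball_subset_ball ((Real.sqrt_le_left hδ.le).2 htδ)))
    _ = ∫⁻ x in ball (0 : EuclideanSpace ℝ (Fin 3)) δ, ‖u t x‖ₑ ^ q := one_mul _

end Summit.NavierStokesRegularity.NavierStokesRegularity.Theorems
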